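import Literature.NumberTheory.Transcendental.CurvePeriodsStokesProofs
import Literature.NumberTheory.Transcendental.CurvePeriodsAffineLineProofs
import Literature.NumberTheory.Transcendental.CurvePeriodsGmLoopsProofs
import HarnessLib

/-!
# Periods of curve type: independence of the embedding (transport along polynomial isomorphisms)

Companion of `Literature/NumberTheory/Transcendental/CurvePeriods.lean` (Huber–Wüstholz 2022,
Thm. 13.3 (2), rendered on EMBEDDED smooth affine curves `Z ⊂ 𝔸ⁿ` over `ℚ̄`). In the book the
objects are abstract pairs `(C, D)`; the rendering uses embedded curves, and its faithfulness
requires that two embeddings of the same curve give the same symbols up to the functoriality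
relation (R4). This file proves that transport: if `φ : Z → Z′` and `ψ : Z′ → Z` are polynomial
maps over `ℚ̄` with `φ ∘ ψ = id` on `Z′`, then every symbol `(Z′, ω′, γ′)` differs from the
symbol `(Z, φ^*ω′, ψ ∘ γ′)` by an elementary relation (`exists_transport`). Consequently the two
toy cases already proved — `𝔸¹` (`huberWustholzCurvePeriods_of_affineLine`) and closed paths on
`𝔾ₘ` (`huberWustholzCurvePeriods_of_mulGroup_closed`) — extend to every curve polynomially
isomorphic to `𝔸¹` (lines in `𝔸ⁿ`, graphs `y = p(x)`, the twisted cubic, …), resp. to closed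
paths on every curve polynomially isomorphic to `𝔾ₘ` (e.g. the circle `x² + y² = 1` via
`(x + iy, x − iy)`): `huberWustholzCurvePeriods_of_iso_affineLine`,
`huberWustholzCurvePeriods_of_iso_mulGroup_closed`.

## References

* A. Huber, G. Wüstholz, *Transcendence and Linear Relations of 1-Periods*, Cambridge Tracts in
  Mathematics 227, CUP 2022 [HuberWustholz2022], §13.1 (B) (functoriality, p. 120 of the held
  text), Thm. 13.3 (2) (p. 121).
-/

noncomputable section

open scoped BigOperators
open MvPolynomial Set

namespace Literature.NumberTheory.Transcendental

namespace CurvePeriods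

/-! ### Polynomial maps of paths and forms -/

/-- A polynomial along a `C¹` path is `C¹`. [folklore] -/
theorem contDiffOn_eval_comp {n : ℕ} {γ : ℝ → (Fin n → ℂ)} {s : Set ℝ}
    (hγ : ContDiffOn ℝ 1 γ s) (P : MvPolynomial (Fin n) ℂ) :
    ContDiffOn ℝ 1 (fun t => eval (γ t) P) s := by
  induction P using MvPolynomial.induction_on with
  | C a => simpa using contDiffOn_const
  | add p q hp hq => simpa using hp.add hq
  | mul_X p i hp => simpa using hp.mul (contDiffOn_pi.1 hγ i)

/-- Finite sums of polynomials over `ℚ̄` are over `ℚ̄`. [folklore] -/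
theorem hasAlgCoeffs_finsetSum {n : ℕ} {ι : Type*} (s : Finset ι)
    (f : ι → MvPolynomial (Fin n) ℂ) (hf : ∀ i ∈ s, HasAlgCoeffs (f i)) :
    HasAlgCoeffs (∑ i ∈ s, f i) :=
  Finset.sum_induction f HasAlgCoeffs (fun _ _ ha hb => ha.add hb) hasAlgCoeffs_zero hf

/-- Finite products of polynomials over `ℚ̄` are over `ℚ̄`. [folklore] -/
theorem hasAlgCoeffs_finsetProd {n : ℕ} {ι : Type*} (s : Finset ι)
    (f : ι → MvPolynomial (Fin n) ℂ) (hf : ∀ i ∈ s, HasAlgCoeffs (f i)) :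
    HasAlgCoeffs (∏ i ∈ s, f i) :=
  Finset.prod_induction f HasAlgCoeffs (fun _ _ ha hb => ha.mul hb) hasAlgCoeffs_one hf

/-- Substitution of polynomials over `ℚ̄` into a polynomial over `ℚ̄` stays over `ℚ̄`.
[folklore] -/
theorem HasAlgCoeffs.bind₁ {n n' : ℕ} {f : Fin n' → MvPolynomial (Fin n) ℂ}
    (hf : ∀ j, HasAlgCoeffs (f j)) {P : MvPolynomial (Fin n') ℂ} (hP : HasAlgCoeffs P) :
    HasAlgCoeffs (bind₁ f P) := by
  classical
  rw [as_sum P, map_sum]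
  refine hasAlgCoeffs_finsetSum _ _ fun d _ => ?_
  rw [bind₁_monomial]
  exact (hasAlgCoeffs_C (hP d)).mul (hasAlgCoeffs_finsetProd _ _ fun j _ => (hf j).pow _)

/-- Pull-backs of forms over `ℚ̄` along maps over `ℚ̄` are over `ℚ̄`. [folklore] -/
theorem HasAlgCoeffs.formPullback {n n' : ℕ} {f : Fin n' → MvPolynomial (Fin n) ℂ}
    (hf : ∀ j, HasAlgCoeffs (f j)) {ω' : Fin n' → MvPolynomial (Fin n') ℂ}
    (h' : ∀ j, HasAlgCoeffs (ω' j)) : ∀ i, HasAlgCoeffs (formPullback f ω' i) := fun i =>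
  hasAlgCoeffs_finsetSum _ _ fun j _ => ((h' j).bind₁ hf).mul ((hf j).pderiv i)

/-! ### Transport of symbols along a polynomial isomorphism -/

/-- **Transport (R4 along an isomorphism)**: let `φ : Z → Z′`, `ψ : Z′ → Z` be polynomial maps
over `ℚ̄` between smooth affine curves with `φ ∘ ψ = id` on the points of `Z′`. Then for every
symbol `(Z′, ω′, γ′)` the path `ψ ∘ γ′` is a `C¹` path on `Z` with algebraic end points, and
`(Z, φ^*ω′, ψ ∘ γ′) − (Z′, ω′, γ′)` is the functoriality relation (R4) along `φ`.
[cite: HuberWustholz2022, §13.1 (B) (p. 120)] -/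
theorem exists_transport {Z Z' : CurveData} (hZ : Z.IsSmoothAffineCurve)
    (hZ' : Z'.IsSmoothAffineCurve) (φ : Fin Z'.n → MvPolynomial (Fin Z.n) ℂ)
    (hφ : ∀ j, HasAlgCoeffs (φ j)) (hφZ : ∀ z ∈ Z.points, (fun j => eval z (φ j)) ∈ Z'.points)
    (ψ : Fin Z.n → MvPolynomial (Fin Z'.n) ℂ) (hψ : ∀ i, HasAlgCoeffs (ψ i))
    (hψZ : ∀ z' ∈ Z'.points, (fun i => eval z' (ψ i)) ∈ Z.points)
    (hinv : ∀ z' ∈ Z'.points, (fun j => eval (fun i => eval z' (ψ i)) (φ j)) = z')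
    (ω' : Fin Z'.n → MvPolynomial (Fin Z'.n) ℂ) (h' : ∀ j, HasAlgCoeffs (ω' j))
    (γ' : CurvePath Z') :
    ∃ γ : CurvePath Z, (∀ t, γ.toFun t = fun i => eval (γ'.toFun t) (ψ i)) ∧
      IsElementaryRelation
        (Finsupp.single (⟨Z, hZ, formPullback φ ω', HasAlgCoeffs.formPullback hφ h', γ⟩ :
            PeriodSymbol) 1 -
          Finsupp.single (⟨Z', hZ', ω', h', γ'⟩ : PeriodSymbol) 1) := by
  let γ : CurvePath Z :=
    { toFun := fun t i => eval (γ'.toFun t) (ψ i)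
      contDiffOn := contDiffOn_pi' fun i => contDiffOn_eval_comp γ'.contDiffOn (ψ i)
      mem_points := fun t ht => hψZ _ (γ'.mem_points t ht)
      algebraic_zero := fun i => (hψ i).isAlgebraic_eval γ'.algebraic_zero
      algebraic_one := fun i => (hψ i).isAlgebraic_eval γ'.algebraic_one }
  refine ⟨γ, fun t => rfl, ?_⟩
  exact IsElementaryRelation.pushforward Z Z' hZ hZ' φ hφ hφZ ω' h' (formPullback φ ω')
    (HasAlgCoeffs.formPullback hφ h') rfl γ γ' fun t ht => (hinv _ (γ'.mem_points t ht)).symm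

/-! ### Transfer of the toy cases along transports -/

/-- **Transfer along symbolwise relations.** If every symbol `s` of `c` is elementary-related to
a symbol `T s` (`(T s) − s` an elementary relation) for which a version of the theorem is known
(all combinations with algebraic coefficients supported on symbols satisfying `P`), then the
theorem holds for `c`. [folklore] -/
theorem span_of_transfer (c : PeriodSymbol →₀ ℂ) (hc : ∀ s, IsAlgebraic ℚ (c s))
    (T : PeriodSymbol → PeriodSymbol)
    (hT : ∀ s ∈ c.support, IsElementaryRelation (Finsupp.single (T s) 1 - Finsupp.single s 1))
    (P : PeriodSymbol → Prop) (hP : ∀ s ∈ c.support, P (T s))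
    (htarget : ∀ c' : PeriodSymbol →₀ ℂ, (∀ s, IsAlgebraic ℚ (c' s)) → (∀ s ∈ c'.support, P s) →
      evalCombination c' = 0 →
        ∃ (k : ℕ) (ρ : Fin k → (PeriodSymbol →₀ ℂ)) (a : Fin k → ℂ),
          (∀ l, IsElementaryRelation (ρ l)) ∧ (∀ l, IsAlgebraic ℚ (a l)) ∧ c' = ∑ l, a l • ρ l)
    (h0 : evalCombination c = 0) :
    ∃ (k : ℕ) (ρ : Fin k → (PeriodSymbol →₀ ℂ)) (a : Fin k → ℂ),
      (∀ l, IsElementaryRelation (ρ l)) ∧ (∀ l, IsAlgebraic ℚ (a l)) ∧ c = ∑ l, a l • ρ l := by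
  classical
  -- the transferred combination
  set c' : PeriodSymbol →₀ ℂ := ∑ s ∈ c.support, c s • Finsupp.single (T s) (1 : ℂ) with hc'
  -- `c − c'` is in the span
  have hdiff : ∀ S : Finset PeriodSymbol, S ⊆ c.support →
      ∃ (k : ℕ) (ρ : Fin k → (PeriodSymbol →₀ ℂ)) (a : Fin k → ℂ),
        (∀ l, IsElementaryRelation (ρ l)) ∧ (∀ l, IsAlgebraic ℚ (a l)) ∧
          ∑ s ∈ S, c s • (Finsupp.single s (1 : ℂ) - Finsupp.single (T s) 1) = ∑ l, a l • ρ l := by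
    intro S hS
    induction S using Finset.induction_on with
    | empty => simpa using span_zero
    | insert s S hs ih =>
      rw [Finset.sum_insert hs]
      refine span_add ?_ (ih (subset_trans (Finset.subset_insert s S) hS))
      have h := span_smul (isAlgebraic_one.neg)
        (span_of_rel (hT s (hS (Finset.mem_insert_self s S))))
      obtain ⟨k, ρ, a, hρ, ha, he⟩ := span_smul (hc s) h
      exact ⟨k, ρ, a, hρ, ha, by rw [← he, smul_smul, mul_neg_one, neg_smul, ← smul_neg, neg_sub]⟩
  have hcc' : c - c' = ∑ s ∈ c.support, c s • (Finsupp.single s (1 : ℂ) - Finsupp.single (T s) 1) := by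
    have hc_eq : c = ∑ s ∈ c.support, c s • Finsupp.single s (1 : ℂ) := by
      conv_lhs => rw [← Finsupp.sum_single c]
      simp only [Finsupp.sum, Finsupp.smul_single_one]
    conv_lhs => rw [hc_eq, hc']
    rw [← Finset.sum_sub_distrib]
    exact Finset.sum_congr rfl fun s _ => by rw [smul_sub]
  obtain ⟨k₁, ρ₁, a₁, hρ₁, ha₁, he₁⟩ := hdiff c.support subset_rfl
  rw [← hcc'] at he₁
  -- `c'` has algebraic coefficients, is supported on `P`-symbols and evaluates to `0`
  have hc'alg : ∀ s, IsAlgebraic ℚ (c' s) := by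
    intro s
    rw [hc', Finsupp.finsetSum_apply]
    refine isAlgebraic_finsetSum _ _ fun s₀ _ => ?_
    rw [Finsupp.smul_apply, Finsupp.single_apply, smul_eq_mul]
    split_ifs
    · simpa using hc s₀
    · rw [mul_zero]; exact isAlgebraic_zero
  have hc'supp : ∀ s ∈ c'.support, P s := by
    intro s hs
    have hs' : s ∈ (c.support).biUnion fun s₀ => (c s₀ • Finsupp.single (T s₀) (1 : ℂ)).support :=
      Finsupp.support_finsetSum hs
    obtain ⟨s₀, hs₀, hmem⟩ := Finset.mem_biUnion.1 hs'
    have : s = T s₀ := (Finsupp.mem_support_single _ _ _ |>.1 (Finsupp.support_smul hmem)).1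
    rw [this]
    exact hP s₀ hs₀
  have hc'ev : evalCombination c' = 0 := by
    have h := evalCombination_eq_zero_of_isElementaryRelation ρ₁ a₁ hρ₁
    rw [← he₁, sub_eq_add_neg, evalCombination_add, ← neg_one_smul ℂ c', evalCombination_smul,
      h0] at h
    linear_combination -h
  obtain ⟨k₂, ρ₂, a₂, hρ₂, ha₂, he₂⟩ := htarget c' hc'alg hc'supp hc'ev
  obtain ⟨k, ρ, a, hρ, ha, he⟩ := span_add ⟨k₁, ρ₁, a₁, hρ₁, ha₁, he₁⟩ ⟨k₂, ρ₂, a₂, hρ₂, ha₂, he₂⟩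
  exact ⟨k, ρ, a, hρ, ha, by rw [← he, sub_add_cancel]⟩

/-- **Huber–Wüstholz 13.3 (2) for curves polynomially isomorphic to `𝔸¹`** (lines in `𝔸ⁿ`,
graphs of polynomials, the twisted cubic, …; toy case of the named fact, proved): if every symbol
of `c` lives on a smooth affine curve `Z` that admits polynomial maps `φ : 𝔸¹ → Z`, `ψ : Z → 𝔸¹`
over `ℚ̄` with `φ ∘ ψ = id` on `Z`, then `Σ c_s ∫_{γ_s} ω_s = 0` implies that `c` is a
`ℚ̄`-combination of elementary relations (transport to `𝔸¹` by (R4), then the `𝔸¹` case).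
[cite: HuberWustholz2022, Thm. 13.3 (2) (p. 121), §13.1 (B) (p. 120)] -/
theorem huberWustholzCurvePeriods_of_iso_affineLine (c : PeriodSymbol →₀ ℂ)
    (hc : ∀ s, IsAlgebraic ℚ (c s))
    (hiso : ∀ s ∈ c.support, ∃ (φ : Fin s.Z.n → MvPolynomial (Fin 1) ℂ)
        (ψ : Fin 1 → MvPolynomial (Fin s.Z.n) ℂ),
      (∀ j, HasAlgCoeffs (φ j)) ∧ (∀ i, HasAlgCoeffs (ψ i)) ∧
        (∀ x : Fin 1 → ℂ, (fun j => eval x (φ j)) ∈ s.Z.points) ∧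
        (∀ z ∈ s.Z.points, (fun j => eval (fun i => eval z (ψ i)) (φ j)) = z))
    (h0 : evalCombination c = 0) :
    ∃ (k : ℕ) (ρ : Fin k → (PeriodSymbol →₀ ℂ)) (a : Fin k → ℂ),
      (∀ l, IsElementaryRelation (ρ l)) ∧ (∀ l, IsAlgebraic ℚ (a l)) ∧ c = ∑ l, a l • ρ l := by
  classical
  -- choose a transported symbol on `𝔸¹` for every symbol of `c`
  have key : ∀ s : PeriodSymbol, ∃ s₁ : PeriodSymbol, s ∈ c.support →
      (s₁.Z = CurveData.affineLine ∧
        IsElementaryRelation (Finsupp.single s₁ 1 - Finsupp.single s 1)) := by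
    intro s
    by_cases hs : s ∈ c.support
    · obtain ⟨φ, ψ, hφ, hψ, hφZ, hinv⟩ := hiso s hs
      obtain ⟨γ, _, hrel⟩ := exists_transport CurveData.isSmoothAffineCurve_affineLine s.smooth φ
        hφ (fun x _ => hφZ x) ψ hψ (fun z' _ => by simp) hinv s.ω s.ω_algebraic s.γ
      exact ⟨_, fun _ => ⟨rfl, hrel⟩⟩
    · exact ⟨s, fun h => (hs h).elim⟩
  choose T hT using key
  exact span_of_transfer c hc T (fun s hs => (hT s hs).2) (fun s => s.Z = CurveData.affineLine)
    (fun s hs => (hT s hs).1)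
    (fun c' hc' hsupp h0' => huberWustholzCurvePeriods_of_affineLine c' hc' hsupp h0') h0

/-- **Huber–Wüstholz 13.3 (2) for closed paths on curves polynomially isomorphic to `𝔾ₘ`**
(hyperbolas `xy = a`, the circle `x² + y² = 1` via `(x + iy, x − iy)`, …; toy case of the named
fact, proved): transport to `𝔾ₘ = {xy = 1}` by (R4) — closed paths stay closed — then the
`𝔾ₘ` case. [cite: HuberWustholz2022, Thm. 13.3 (2) (p. 121), §13.1 (B) (p. 120)] -/
theorem huberWustholzCurvePeriods_of_iso_mulGroup_closed (c : PeriodSymbol →₀ ℂ)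
    (hc : ∀ s, IsAlgebraic ℚ (c s))
    (hiso : ∀ s ∈ c.support, s.γ.toFun 1 = s.γ.toFun 0 ∧
      ∃ (φ : Fin s.Z.n → MvPolynomial (Fin 2) ℂ) (ψ : Fin 2 → MvPolynomial (Fin s.Z.n) ℂ),
        (∀ j, HasAlgCoeffs (φ j)) ∧ (∀ i, HasAlgCoeffs (ψ i)) ∧
          (∀ x ∈ (⟨2, 1, ![X 0 * X 1 - 1]⟩ : CurveData).points,
            (fun j => eval x (φ j)) ∈ s.Z.points) ∧
          (∀ z ∈ s.Z.points,
            (fun i => eval z (ψ i)) ∈ (⟨2, 1, ![X 0 * X 1 - 1]⟩ : CurveData).points) ∧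
          (∀ z ∈ s.Z.points, (fun j => eval (fun i => eval z (ψ i)) (φ j)) = z))
    (h0 : evalCombination c = 0) :
    ∃ (k : ℕ) (ρ : Fin k → (PeriodSymbol →₀ ℂ)) (a : Fin k → ℂ),
      (∀ l, IsElementaryRelation (ρ l)) ∧ (∀ l, IsAlgebraic ℚ (a l)) ∧ c = ∑ l, a l • ρ l := by
  classical
  have key : ∀ s : PeriodSymbol, ∃ s₁ : PeriodSymbol, s ∈ c.support →
      ((s₁.Z = (⟨2, 1, ![X 0 * X 1 - 1]⟩ : CurveData) ∧ s₁.γ.toFun 1 = s₁.γ.toFun 0) ∧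
        IsElementaryRelation (Finsupp.single s₁ 1 - Finsupp.single s 1)) := by
    intro s
    by_cases hs : s ∈ c.support
    · obtain ⟨hcl, φ, ψ, hφ, hψ, hφZ, hψZ, hinv⟩ := hiso s hs
      obtain ⟨γ, hγ, hrel⟩ := exists_transport isSmoothAffineCurve_mulGroup s.smooth φ hφ hφZ ψ
        hψ hψZ hinv s.ω s.ω_algebraic s.γ
      refine ⟨_, fun _ => ⟨⟨rfl, ?_⟩, hrel⟩⟩
      show γ.toFun 1 = γ.toFun 0
      rw [hγ 1, hγ 0, hcl]
    · exact ⟨s, fun h => (hs h).elim⟩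
  choose T hT using key
  exact span_of_transfer c hc T (fun s hs => (hT s hs).2)
    (fun s => s.Z = (⟨2, 1, ![X 0 * X 1 - 1]⟩ : CurveData) ∧ s.γ.toFun 1 = s.γ.toFun 0)
    (fun s hs => (hT s hs).1)
    (fun c' hc' hsupp h0' => huberWustholzCurvePeriods_of_mulGroup_closed c' hc' hsupp h0') h0

end CurvePeriods

end Literature.NumberTheory.Transcendental

end
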